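import Summits.CriticalPhenomena.PercolationContinuityZ3.Cruxes.SupercritExchangeUniformity.FwdRungG8
import Summits.CriticalPhenomena.PercolationContinuityZ3.Cruxes.SupercritExchangeUniformity.Lines.isotropic_locus_continuity
import Summits.CriticalPhenomena.PercolationContinuityZ3.Theorems.PercExchangeRateTransportIsoLocusOnPathCore

/-!
# Forward generator G1 `next-rung`, generation 32 — seed `CriticalCurveRegular` (stmt-CriticalPhenomena-16065)

Coverage certificate of planner-fwd2-rung-CriticalPhenomena-01-g32-0 (no filing; 27th consecutive
`found-nothing` on this seed).  Floor = `Cruxes.CriticalCurveRegular.Locmod.CriticalCurveRegular_proof`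
(continuity of the anisotropic critical curve `t ↦ p_c(t)` of the label-coupled bond family on `ℤ²×ℤ`,
`0 < p_c < 1`); `S` = `PercolationContinuityZ3` (`θ_{ℤ³}(p_c) = 0`); `p₃ := p_c(ℤ³)`;
`J(t) := θ(p_c(t), t)` the critical density ON the curve; `Θ_n` the finite-volume densities.

The two cells over this floor not typed by generations 1–31, and why neither is a rung:

* `LiminfIsoNull` (LIZ): `J` takes values `< ε` at levels `t ≠ p₃` arbitrarily close to `p₃`
  (`liminf_{t → p₃, t ≠ p₃} J(t) = 0`).  ON-PATH (`liminfIsoNull_of_summit`).  But it is EXACTLY the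
  residual conjunct of generation 1's registered rung `IsoLocus.IsotropicLocusContinuity`
  (`Lines/isotropic_locus_continuity.lean`):
  `summit_iff_isotropicLocusContinuity_and_liminfIsoNull : S ↔ IsotropicLocusContinuity ∧ LiminfIsoNull`.
  So LIZ is the summit modulo a filed rung, it carries no lever of its own (no curve / exchange-rate
  structure enters: it is a bare `∃`-statement about small values of `θ` near the isotropic corner —
  generation 13's `ZeroSomewhereOnArc` class), and in a jump world (`θ_{ℤ³}(p_c) > 0`) nothing known
  makes it plausible independently of `S`.  Verdict: costume of `S` relative to the gen-1 line; not filed.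

* `CurveWindowNullSeq` (finite-size window along the curve): `Θ_n(p_c(t_n), t_n) → 0` for EVERY level
  sequence `t_n → p₃` in `(0,1)`.  ON-PATH for every sequence (`curveWindowNullSeq_of_summit`; this corrects
  generation 23's cell C2, which recorded the window cells as off-path: `Θ_n ≤ Θ_m` for `m ≤ n`, continuity
  of `Θ_m` and of `p_c` at `p₃`, and `inf_m Θ_m(p₃,p₃) = θ(p₃,p₃) = 0` under `S`), and conversely the
  constant sequence `t_n ≡ p₃` gives `S` back (`summit_of_curveWindowNullSeq`): `⟺ S`, costume.  Its
  punctured version (`t_n ≠ p₃`) implies LIZ (`liminfIsoNull_of_curveWindowNullPunctured`), i.e. it is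
  LIZ plus a finite-size-scaling strengthening with no lander in the tree or in print.

Everything here is sorry-free (the imported line file `Lines/isotropic_locus_continuity.lean` carries its
two registered `stub_*` sorries; only its sorry-free `def`s are used here).
-/

noncomputable section

namespace Summit.CriticalPhenomena.PercolationContinuityZ3.Cruxes.SupercritExchangeUniformity.LiminfIso

open Filter Topology
open Literature.Probability.Percolation Literature.Probability.LatticeModels
open Summit.CriticalPhenomena.PercolationContinuityZ3.Theses.PercExchangeRateTransport
open Summit.CriticalPhenomena.PercolationContinuityZ3.Theorems
open Summit.CriticalPhenomena.PercolationContinuityZ3.Theorems.SubcritExchangeUniformity.Negative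
  (thetaPerc pcurve ThetaBox)
open Summit.CriticalPhenomena.PercolationContinuityZ3.Cruxes.SupercritExchangeUniformity.FwdRungG8
  (p3_mem_Ioo thetaPerc_mono thetaPerc_nonneg thetaPerc_diag thetaPerc_corner_eq_zero_of_S
    S_of_thetaPerc_corner_eq_zero)

/-- `p₃ = p_c(ℤ³)` (input notation only). -/
local notation "𝔭₃" => Literature.Probability.Percolation.criticalProb
  (Literature.Probability.LatticeModels.zdGraph 3) (0 : Literature.Probability.LatticeModels.Site 3)

/-! ### The route's objects: clauses of `modelFacts_proof` and of the floor over the named objects -/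

/-- The critical density on the curve, `J(t) = θ(p_c(t), t)`. -/
def J (t : ℝ) : ℝ := thetaPerc (pcurve t) t

theorem J_nonneg (t : ℝ) : 0 ≤ J t := thetaPerc_nonneg _ _

theorem thetaBox_continuous (n : ℕ) : Continuous (fun x : ℝ × ℝ => ThetaBox n x.1 x.2) := by
  obtain ⟨h1, -⟩ := ModelFacts.modelFacts_proof
  exact h1 n

theorem thetaBox_antitone (p t : ℝ) : Antitone (fun n => ThetaBox n p t) := by
  obtain ⟨-, -, -, -, h5, -⟩ := ModelFacts.modelFacts_proof
  exact h5 p t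

theorem thetaBox_nonneg (n : ℕ) (p t : ℝ) : 0 ≤ ThetaBox n p t := by
  obtain ⟨-, -, -, -, -, h6, -⟩ := ModelFacts.modelFacts_proof
  exact (h6 n p t).1

theorem thetaPerc_eq_iInf (p t : ℝ) : thetaPerc p t = ⨅ n, ThetaBox n p t := by
  obtain ⟨-, -, -, -, -, -, h7, -⟩ := ModelFacts.modelFacts_proof
  exact h7 p t

theorem thetaPerc_le_thetaBox (n : ℕ) (p t : ℝ) : thetaPerc p t ≤ ThetaBox n p t := by
  rw [thetaPerc_eq_iInf]
  exact ciInf_le ⟨0, by rintro _ ⟨m, rfl⟩; exact thetaBox_nonneg m p t⟩ n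

/-- Floor, first atom: the critical curve is continuous on `(0,1)`. -/
theorem pcurve_continuousOn : ContinuousOn pcurve (Set.Ioo 0 1) := by
  obtain ⟨hcc1, -⟩ :=
    Summit.CriticalPhenomena.PercolationContinuityZ3.Cruxes.CriticalCurveRegular.Locmod.CriticalCurveRegular_proof
  exact hcc1

/-- The curve passes through the isotropic point (floor + diagonal phase structure;
`IsoLocusOnPathCore.curve_fixes_isotropic_point`). -/
theorem pcurve_p3 : pcurve 𝔭₃ = 𝔭₃ := by
  obtain ⟨-, -, h3, h4, -, h6, h7, -, h9, -⟩ := ModelFacts.modelFacts_proof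
  exact IsoLocusOnPathCore.curve_fixes_isotropic_point (Θ := ThetaBox) (θ := thetaPerc) (pc := pcurve)
    (th3 := theta (zdGraph 3) 0) h7 (fun _ => rfl) h3 h4 (fun n p t => (h6 n p t).1) h9
    pcurve_continuousOn p3_mem_Ioo.1 p3_mem_Ioo.2
    (fun p hp => theta_eq_zero_of_lt_criticalProb_holds _ _ p hp)
    (fun p hp => theta_pos_of_criticalProb_lt_holds _ _ p hp)

theorem J_p3 : J 𝔭₃ = thetaPerc 𝔭₃ 𝔭₃ := by
  show thetaPerc (pcurve 𝔭₃) 𝔭₃ = _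
  rw [pcurve_p3]

theorem J_p3_eq_zero_of_summit (hS : _root_.PercolationContinuityZ3) : J 𝔭₃ = 0 :=
  J_p3.trans (thetaPerc_corner_eq_zero_of_S hS)

/-! ### Generation 1's isotropic conjunct, by name -/

/-- The isotropic conjunct of generation 1's rung: `J` is continuous within `(0,1)` at `p₃`. -/
def LocusContinuousAtIso : Prop := ContinuousWithinAt J (Set.Ioo 0 1) 𝔭₃

/-- `IsoLocus.IsotropicLocusContinuity` (= floor ∧ the conjunct at `T = {p₃}`) is, over the PROVED floor,
exactly `LocusContinuousAtIso`. -/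
theorem isotropicLocusContinuity_iff : IsoLocus.IsotropicLocusContinuity ↔ LocusContinuousAtIso := by
  constructor
  · intro h
    obtain ⟨-, h2⟩ := h
    exact h2 _ (Set.mem_singleton _) p3_mem_Ioo
  · intro hc
    delta IsoLocus.IsotropicLocusContinuity IsoLocus.CriticalLocusContinuous
    intro μ vert cfg θ pc
    refine ⟨Summit.CriticalPhenomena.PercolationContinuityZ3.Cruxes.CriticalCurveRegular.Locmod.CriticalCurveRegular_proof, ?_⟩
    intro t₀ ht₀ _
    rw [Set.mem_singleton_iff] at ht₀
    subst ht₀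
    exact hc

/-- ON-PATH for the conjunct (the landed gen-1 on-path lemma, re-derived from `IsoLocusOnPathCore`). -/
theorem locusContinuousAtIso_of_summit (hS : _root_.PercolationContinuityZ3) : LocusContinuousAtIso := by
  obtain ⟨h1, -, h3, h4, -, h6, h7, -, h9, -⟩ := ModelFacts.modelFacts_proof
  exact IsoLocusOnPathCore.locus_continuousWithinAt_of_diag_zero (Θ := ThetaBox) (θ := thetaPerc)
    (pc := pcurve) (th3 := theta (zdGraph 3) 0) (criticalProb_mem_Icc (zdGraph 3) 0) h7 (fun _ => rfl)
    h1 h3 h4 (fun n p t => (h6 n p t).1) h9 pcurve_continuousOn p3_mem_Ioo.1 p3_mem_Ioo.2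
    (fun p hp => theta_eq_zero_of_lt_criticalProb_holds _ _ p hp)
    (fun p hp => theta_pos_of_criticalProb_lt_holds _ _ p hp) hS

/-! ### CELL `LiminfIsoNull` (LIZ) -/

/-- CELL (LIZ). `liminf_{t → p₃, t ≠ p₃} J(t) = 0`: for every `ε, δ > 0` there is a level `t ∈ (0,1)`,
`t ≠ p₃`, `|t - p₃| < δ`, with `J(t) = θ(p_c(t),t) < ε`. [conjecture; `⟺ S` modulo gen 1's rung] -/
def LiminfIsoNull : Prop :=
  ∀ ε : ℝ, 0 < ε → ∀ δ : ℝ, 0 < δ →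
    ∃ t ∈ Set.Ioo (0 : ℝ) 1, t ≠ 𝔭₃ ∧ |t - 𝔭₃| < δ ∧ J t < ε

/-- The floor-relative rung form (F3: floor ∧ cell). -/
def IsoLiminfNull : Prop := CriticalCurveRegular ∧ LiminfIsoNull

/-- **ON-PATH.** `S → LIZ`: under `S`, `J(p₃) = θ(p₃,p₃) = 0` and `J` is continuous within `(0,1)` at `p₃`. -/
theorem liminfIsoNull_of_summit (hS : _root_.PercolationContinuityZ3) : LiminfIsoNull := by
  intro ε hε δ hδ
  have hc := locusContinuousAtIso_of_summit hS
  rw [LocusContinuousAtIso, Metric.continuousWithinAt_iff] at hc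
  obtain ⟨δ', hδ', h⟩ := hc ε hε
  obtain ⟨h3l, h3u⟩ := p3_mem_Ioo
  obtain ⟨s, hs0, hsδ, hsδ', hs1⟩ : ∃ s : ℝ, 0 < s ∧ s < δ ∧ s < δ' ∧ s < 1 - 𝔭₃ := by
    refine ⟨min (min δ δ') (1 - 𝔭₃) / 2, ?_, ?_, ?_, ?_⟩
    · have : 0 < min (min δ δ') (1 - 𝔭₃) := lt_min (lt_min hδ hδ') (by linarith); linarith
    · have : min (min δ δ') (1 - 𝔭₃) ≤ δ := (min_le_left _ _).trans (min_le_left _ _); linarith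
    · have : min (min δ δ') (1 - 𝔭₃) ≤ δ' := (min_le_left _ _).trans (min_le_right _ _); linarith
    · have : min (min δ δ') (1 - 𝔭₃) ≤ 1 - 𝔭₃ := min_le_right _ _; linarith
  have hmem : 𝔭₃ + s ∈ Set.Ioo (0 : ℝ) 1 := ⟨by linarith, by linarith⟩
  refine ⟨𝔭₃ + s, hmem, by intro h'; linarith, ?_, ?_⟩
  · rw [show 𝔭₃ + s - 𝔭₃ = s by ring, abs_of_pos hs0]; exact hsδ
  · have hdist : dist (𝔭₃ + s) 𝔭₃ < δ' := by
      rw [Real.dist_eq, show 𝔭₃ + s - 𝔭₃ = s by ring, abs_of_pos hs0]; exact hsδ'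
    have hx := h hmem hdist
    rw [J_p3_eq_zero_of_summit hS, Real.dist_eq, sub_zero, abs_of_nonneg (J_nonneg _)] at hx
    exact hx

theorem isoLiminfNull_of_summit (hS : _root_.PercolationContinuityZ3) : IsoLiminfNull :=
  ⟨Summit.CriticalPhenomena.PercolationContinuityZ3.Cruxes.CriticalCurveRegular.Locmod.CriticalCurveRegular_proof,
    liminfIsoNull_of_summit hS⟩

theorem floor_of_rung : IsoLiminfNull → CriticalCurveRegular := fun h => h.1

/-- `S → floor ∧ LIZ → floor`. -/
theorem rung_between :
    (_root_.PercolationContinuityZ3 → IsoLiminfNull) ∧ (IsoLiminfNull → CriticalCurveRegular) :=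
  ⟨isoLiminfNull_of_summit, floor_of_rung⟩

/-- **LIZ IS THE RESIDUAL CONJUNCT OF GEN 1's RUNG.** Continuity of `J` at `p₃` and LIZ give
`J(p₃) = 0`, i.e. `θ(p₃,p₃) = θ_{ℤ³}(p_c) = 0`. -/
theorem summit_of_locusContinuousAtIso_of_liminfIsoNull (hc : LocusContinuousAtIso)
    (hl : LiminfIsoNull) : _root_.PercolationContinuityZ3 := by
  apply S_of_thetaPerc_corner_eq_zero
  rw [← J_p3]
  refine le_antisymm ?_ (J_nonneg _)
  by_contra hpos'
  have hpos : 0 < J 𝔭₃ := lt_of_not_ge hpos'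
  rw [LocusContinuousAtIso, Metric.continuousWithinAt_iff] at hc
  obtain ⟨δ, hδ, h⟩ := hc (J 𝔭₃ / 2) (by linarith)
  obtain ⟨t, ht, -, hdist, hJt⟩ := hl (J 𝔭₃ / 2) (by linarith) δ hδ
  have hx := h ht (by rwa [Real.dist_eq])
  rw [Real.dist_eq] at hx
  have hx' := (abs_sub_lt_iff.mp hx).2
  linarith

/-- `S ⟺ (J continuous at p₃ within (0,1)) ∧ LIZ`. -/
theorem summit_iff_locusContinuousAtIso_and_liminfIsoNull :
    _root_.PercolationContinuityZ3 ↔ LocusContinuousAtIso ∧ LiminfIsoNull :=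
  ⟨fun hS => ⟨locusContinuousAtIso_of_summit hS, liminfIsoNull_of_summit hS⟩,
    fun h => summit_of_locusContinuousAtIso_of_liminfIsoNull h.1 h.2⟩

/-- **HEADLINE.** `S ⟺ IsotropicLocusContinuity ∧ LiminfIsoNull`: generation 1's registered rung and the
cell LIZ are complementary conjuncts of the sub-problem statement (over the proved floor). -/
theorem summit_iff_isotropicLocusContinuity_and_liminfIsoNull :
    _root_.PercolationContinuityZ3 ↔ IsoLocus.IsotropicLocusContinuity ∧ LiminfIsoNull := by
  rw [isotropicLocusContinuity_iff]
  exact summit_iff_locusContinuousAtIso_and_liminfIsoNull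

/-- Floor-relative form of the headline. -/
theorem summit_iff_isotropicLocusContinuity_and_isoLiminfNull :
    _root_.PercolationContinuityZ3 ↔ IsoLocus.IsotropicLocusContinuity ∧ IsoLiminfNull :=
  ⟨fun hS => ⟨(summit_iff_isotropicLocusContinuity_and_liminfIsoNull.mp hS).1, isoLiminfNull_of_summit hS⟩,
    fun h => summit_iff_isotropicLocusContinuity_and_liminfIsoNull.mpr ⟨h.1, h.2.2⟩⟩

/-! ### CELL `CurveWindowNullSeq` (finite-size window along the curve; corrects gen 23, cell C2) -/

/-- CELL. For every level sequence `t_n → p₃` in `(0,1)`, the size-`n` density at the critical point of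
level `t_n` tends to `0`: `Θ_n(p_c(t_n), t_n) → 0`. [`⟺ S`] -/
def CurveWindowNullSeq : Prop :=
  ∀ u : ℕ → ℝ, (∀ n, u n ∈ Set.Ioo (0 : ℝ) 1) → Tendsto u atTop (𝓝 𝔭₃) →
    Tendsto (fun n => ThetaBox n (pcurve (u n)) (u n)) atTop (𝓝 0)

/-- The punctured version (`t_n ≠ p₃`). [conjecture; `S ⇒ it ⇒ LIZ`] -/
def CurveWindowNullPunctured : Prop :=
  ∀ u : ℕ → ℝ, (∀ n, u n ∈ Set.Ioo (0 : ℝ) 1) → (∀ n, u n ≠ 𝔭₃) → Tendsto u atTop (𝓝 𝔭₃) →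
    Tendsto (fun n => ThetaBox n (pcurve (u n)) (u n)) atTop (𝓝 0)

/-- **ON-PATH for every sequence.** Under `S`: `inf_m Θ_m(p₃,p₃) = θ(p₃,p₃) = 0` gives `m` with
`Θ_m(p₃,p₃) < ε`; continuity of `Θ_m` and of `p_c` at `p₃` (with `p_c(p₃) = p₃`) gives
`Θ_m(p_c(t_n),t_n) < ε` for large `n`; and `Θ_n ≤ Θ_m` for `n ≥ m`. -/
theorem curveWindowNullSeq_of_summit (hS : _root_.PercolationContinuityZ3) : CurveWindowNullSeq := by
  intro u hu hlim
  rw [Metric.tendsto_atTop]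
  intro ε hε
  have h0 : thetaPerc 𝔭₃ 𝔭₃ = 0 := thetaPerc_corner_eq_zero_of_S hS
  have hlt : (⨅ n, ThetaBox n 𝔭₃ 𝔭₃) < ε := by rw [← thetaPerc_eq_iInf, h0]; exact hε
  obtain ⟨m, hm⟩ := exists_lt_of_ciInf_lt hlt
  have hopen : IsOpen {x : ℝ × ℝ | ThetaBox m x.1 x.2 < ε} :=
    isOpen_lt (thetaBox_continuous m) continuous_const
  obtain ⟨r, hr, hball⟩ := Metric.isOpen_iff.mp hopen (𝔭₃, 𝔭₃) hm
  have hcw : ContinuousWithinAt pcurve (Set.Ioo 0 1) 𝔭₃ := pcurve_continuousOn 𝔭₃ p3_mem_Ioo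
  rw [Metric.continuousWithinAt_iff] at hcw
  obtain ⟨δ₁, hδ₁, hδ₁'⟩ := hcw r hr
  rw [Metric.tendsto_atTop] at hlim
  obtain ⟨N, hN⟩ := hlim (min δ₁ r) (lt_min hδ₁ hr)
  refine ⟨max N m, fun n hn => ?_⟩
  have hnN : N ≤ n := le_trans (le_max_left _ _) hn
  have hnm : m ≤ n := le_trans (le_max_right _ _) hn
  have hd := hN n hnN
  have hd1 : dist (u n) 𝔭₃ < δ₁ := lt_of_lt_of_le hd (min_le_left _ _)
  have hd2 : dist (u n) 𝔭₃ < r := lt_of_lt_of_le hd (min_le_right _ _)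
  have hpcd : dist (pcurve (u n)) 𝔭₃ < r := by
    have h := hδ₁' (hu n) hd1
    rwa [pcurve_p3] at h
  have hΘm : ThetaBox m (pcurve (u n)) (u n) < ε := by
    have hmem : ((pcurve (u n), u n) : ℝ × ℝ) ∈ Metric.ball ((𝔭₃, 𝔭₃) : ℝ × ℝ) r := by
      rw [Metric.mem_ball, Prod.dist_eq]; exact max_lt hpcd hd2
    exact hball hmem
  have hΘn : ThetaBox n (pcurve (u n)) (u n) ≤ ThetaBox m (pcurve (u n)) (u n) :=
    thetaBox_antitone _ _ hnm
  rw [Real.dist_eq, sub_zero, abs_of_nonneg (thetaBox_nonneg _ _ _)]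
  exact lt_of_le_of_lt hΘn hΘm

/-- … and the constant sequence `t_n ≡ p₃` gives `S` back: the cell is `⟺ S` (costume). -/
theorem summit_of_curveWindowNullSeq (h : CurveWindowNullSeq) : _root_.PercolationContinuityZ3 := by
  have ht := h (fun _ => 𝔭₃) (fun _ => p3_mem_Ioo) tendsto_const_nhds
  rw [pcurve_p3] at ht
  have hle : thetaPerc 𝔭₃ 𝔭₃ ≤ 0 := ge_of_tendsto' ht (fun n => thetaPerc_le_thetaBox n _ _)
  exact S_of_thetaPerc_corner_eq_zero (le_antisymm hle (thetaPerc_nonneg _ _))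

theorem curveWindowNullSeq_iff_summit : CurveWindowNullSeq ↔ _root_.PercolationContinuityZ3 :=
  ⟨summit_of_curveWindowNullSeq, curveWindowNullSeq_of_summit⟩

theorem curveWindowNullPunctured_of_seq (h : CurveWindowNullSeq) : CurveWindowNullPunctured :=
  fun u hu _ hlim => h u hu hlim

theorem curveWindowNullPunctured_of_summit (hS : _root_.PercolationContinuityZ3) :
    CurveWindowNullPunctured :=
  curveWindowNullPunctured_of_seq (curveWindowNullSeq_of_summit hS)

/-- The punctured window cell implies LIZ (`J(t_n) ≤ Θ_n(p_c(t_n),t_n)` along `t_n = p₃ + (1-p₃)/(n+2)`),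
so it is LIZ plus a finite-size strengthening — summit-strength modulo gen 1's rung as well. -/
theorem liminfIsoNull_of_curveWindowNullPunctured (h : CurveWindowNullPunctured) : LiminfIsoNull := by
  intro ε hε δ hδ
  obtain ⟨h3l, h3u⟩ := p3_mem_Ioo
  have hc : 0 < 1 - 𝔭₃ := by linarith
  let u : ℕ → ℝ := fun n => 𝔭₃ + (1 - 𝔭₃) / ((n : ℝ) + 2)
  have hpos : ∀ n : ℕ, 0 < (1 - 𝔭₃) / ((n : ℝ) + 2) := fun n => div_pos hc (by positivity)
  have hlt1 : ∀ n : ℕ, (1 - 𝔭₃) / ((n : ℝ) + 2) < 1 - 𝔭₃ := fun n => by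
    have hn2 : (0 : ℝ) < (n : ℝ) + 2 := by positivity
    rw [div_lt_iff₀ hn2]
    have h1 : (1 : ℝ) < (n : ℝ) + 2 := by
      have : (0 : ℝ) ≤ (n : ℝ) := Nat.cast_nonneg n
      linarith
    calc (1 - 𝔭₃) = (1 - 𝔭₃) * 1 := (mul_one _).symm
      _ < (1 - 𝔭₃) * ((n : ℝ) + 2) := mul_lt_mul_of_pos_left h1 hc
  have hu : ∀ n, u n ∈ Set.Ioo (0 : ℝ) 1 := fun n => by
    have := hpos n; have := hlt1 n
    constructor <;> simp only [u] <;> linarith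
  have hne : ∀ n, u n ≠ 𝔭₃ := fun n => by
    have := hpos n
    simp only [u]; intro h'; linarith
  have hlim : Tendsto u atTop (𝓝 𝔭₃) := by
    have h1 : Tendsto (fun n : ℕ => (n : ℝ) + 2) atTop atTop :=
      tendsto_atTop_add_const_right atTop (2 : ℝ) tendsto_natCast_atTop_atTop
    have h2 : Tendsto (fun n : ℕ => (1 - 𝔭₃) / ((n : ℝ) + 2)) atTop (𝓝 0) :=
      tendsto_const_nhds.div_atTop h1
    have h3 := h2.const_add 𝔭₃
    rw [add_zero] at h3
    exact h3
  have hT := h u hu hne hlim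
  rw [Metric.tendsto_atTop] at hT hlim
  obtain ⟨N₁, hN₁⟩ := hT ε hε
  obtain ⟨N₂, hN₂⟩ := hlim δ hδ
  refine ⟨u (max N₁ N₂), hu _, hne _, ?_, ?_⟩
  · have h' := hN₂ (max N₁ N₂) (le_max_right _ _)
    rwa [Real.dist_eq] at h'
  · have h' := hN₁ (max N₁ N₂) (le_max_left _ _)
    rw [Real.dist_eq, sub_zero, abs_of_nonneg (thetaBox_nonneg _ _ _)] at h'
    show thetaPerc (pcurve (u (max N₁ N₂))) (u (max N₁ N₂)) < ε
    exact lt_of_le_of_lt (thetaPerc_le_thetaBox _ _ _) h'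

/-- Summary of the window class: `S ⟺ CurveWindowNullSeq ⇒ CurveWindowNullPunctured ⇒ LIZ`, and
`LIZ ∧ IsotropicLocusContinuity ⟺ S`. -/
theorem window_class_summary :
    (CurveWindowNullSeq ↔ _root_.PercolationContinuityZ3) ∧
    (CurveWindowNullSeq → CurveWindowNullPunctured) ∧
    (CurveWindowNullPunctured → LiminfIsoNull) ∧
    (IsoLocus.IsotropicLocusContinuity ∧ LiminfIsoNull ↔ _root_.PercolationContinuityZ3) :=
  ⟨curveWindowNullSeq_iff_summit, curveWindowNullPunctured_of_seq,
    liminfIsoNull_of_curveWindowNullPunctured, summit_iff_isotropicLocusContinuity_and_liminfIsoNull.symm⟩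

end Summit.CriticalPhenomena.PercolationContinuityZ3.Cruxes.SupercritExchangeUniformity.LiminfIso

end
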